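import Summits.PneNP.PneNP.Theorems.SymmetryBudgetWindowCanoniserLevelsShared

/-!
# Window canoniser, VI: every wire of a replay gate points down

Route `PneNP/SymmetryBudget`, dichotomy `WindowBarrier` (stmt-PneNP-2145) / `NoHiddenOrder` (stmt-PneNP-14781);
continuation of `…WindowCanoniserLevelsShared.lean`: `WCan.OK a.al (a.args i)` for the replay atoms
(`Kind.argsR_ok`).
-/

-- `Summit.PneNP.PneNP.…` duplicates `PneNP` BY DESIGN (single-problem summit, D-0017 layout).
set_option linter.dupNamespace false

noncomputable section

namespace Summit.PneNP.PneNP.Theorems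

namespace WCan

open Finset Equiv Literature.Computability.Complexity

variable {K r n : ℕ} [NeZero n]

/-! ### Replay atoms -/

section Replay

variable (L : Lab K n)

omit [NeZero n] in
/-- Shared atoms are below the label. -/
theorem al_sh_lt (k : SKind) (P : Prm r n) (e : ℕ) : (Atom.sh k P : Atom K r n).al < lb L + e := by
  have := SKind.al_lt k P (n := n)
  show SKind.al n P k < SH n + _ + e
  omega

/-- `al_adjLit_lt`: bookkeeping/simp lemma (al adjLit lt). -/
theorem al_adjLit_lt (u v : Fin n) (e : ℕ) : (adjLit (K := K) (r := r) u v).1.al < lb L + e := by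
  rw [al_adjLit]; simp [SH]

/-- `al_nadjLit_lt`: bookkeeping/simp lemma (al nadjLit lt). -/
theorem al_nadjLit_lt (u v : Fin n) (e : ℕ) : (nadjLit (K := K) (r := r) u v).1.al < lb L + e := by
  rw [al_nadjLit]; simp [SH]

omit [NeZero n] in
/-- `al_ttA_lt`: bookkeeping/simp lemma (al ttA lt). -/
theorem al_ttA_lt (e : ℕ) : (ttA : Atom K r n).al < lb L + e := by simp [SH]
omit [NeZero n] in
/-- `al_ffA_lt`: bookkeeping/simp lemma (al ffA lt). -/
theorem al_ffA_lt (e : ℕ) : (ffA : Atom K r n).al < lb L + e := by simp [SH]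
omit [NeZero n] in
/-- `lb_pos`: bookkeeping/simp lemma (lb pos). -/
theorem lb_pos (e : ℕ) : 0 < lb L + e := by simp [SH]

omit [NeZero n] in
/-- The level of a replay atom. -/
theorem al_lab_replay (k : Kind) (P : Prm r n) : (Atom.lab L k P : Atom K r n).al = lb L + k.loc n P := rfl

/-- `ok_WEF`: bookkeeping/simp lemma (ok WEF). -/
theorem ok_WEF {c : ℕ} (it : Fin (T n + 1)) (v y : Fin n) (h : lb L + it * RS n < c) : N1ok c (WEF (r := r) L it v y) :=
  n1ok_n1and (by (simp; omega)) (by omega)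

/-- `ok_nWEF`: bookkeeping/simp lemma (ok nWEF). -/
theorem ok_nWEF {c : ℕ} (it : Fin (T n + 1)) (v y : Fin n) (h : lb L + it * RS n < c) : N1ok c (nWEF (r := r) L it v y) :=
  n1ok_n1or (by (simp; omega)) (by omega)

/-- `ok_iLTW`: bookkeeping/simp lemma (ok iLTW). -/
theorem ok_iLTW (it : Fin (T n + 1)) (u w : Fin n) {c : ℕ} (h : lb L + (it * RS n + 3) < c) :
    OK c (iLTW (r := r) L it u w) := by
  unfold iLTW
  split_ifs
  · exact ok_wA (by (simp; omega))
  · refine ok_w2_n2or ?_ (by omega)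
    simp only [List.mem_cons, List.not_mem_nil, or_false, forall_eq_or_imp, forall_eq]
    refine ⟨n1ok_n1and ?_ (by omega), n1ok_n1and ?_ (by omega), n1ok_n1and ?_ (by omega)⟩ <;>
      simp only [List.mem_cons, List.not_mem_nil, or_false, forall_eq_or_imp, forall_eq, al_aW, al_aSel, al_aLT] <;> omega

/-- `ok_reach0W`: bookkeeping/simp lemma (ok reach0W). -/
theorem ok_reach0W (it : Fin (T n + 1)) (u y : Fin n) {c : ℕ} (h : lb L + (it * RS n + 1) < c) :
    OK c (reach0W (r := r) L it u y) := by
  unfold reach0W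
  split_ifs
  · exact ok_wA (by (simp; omega))
  · refine ok_w2_n2or ?_ (by omega)
    simp only [List.mem_cons, List.not_mem_nil, or_false, forall_eq_or_imp, forall_eq]
    refine ⟨n1ok_n1and ?_ (by omega), n1ok_n1and ?_ (by omega)⟩ <;>
      simp only [List.mem_cons, List.not_mem_nil, or_false, forall_eq_or_imp, forall_eq, al_aW, al_aSw, al_aExV] <;> omega

set_option maxHeartbeats 1600000 in
/-- **Every wire of a replay atom points down.** -/
theorem Kind.argsR_ok (k : Kind) (hk : k.isReplay = true) (P : Prm r n) (i : Fin (k.fn r n).1) :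
    OK (Atom.lab L k P : Atom K r n).al (k.argsR L P i) := by
  rw [al_lab_replay]
  have hRS : RS n = 4 * n + 8 := rfl
  have hsh := al_sh_lt (K := K) (r := r) L
  cases k <;> simp [Kind.isReplay] at hk <;> simp only [Kind.argsR, Kind.loc]
  case sW =>
    rcases hit : P.it with ⟨_ | it, ht⟩
    · exact ok_wA (al_ttA_lt L _)
    · have hmul : (it + 1) * RS n = it * RS n + RS n := Nat.succ_mul _ _
      refine ok_w2_n2and ?_ (lb_pos L _)
      simp only [List.mem_cons, List.not_mem_nil, or_false, forall_eq_or_imp, forall_eq]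
      refine ⟨n1ok_litN1 (by (simp; omega)) (lb_pos L _), n1ok_n1or ?_ (lb_pos L _)⟩
      simp only [List.mem_cons, List.not_mem_nil, or_false, forall_eq_or_imp, forall_eq, al_aFrz, al_aConn, al_aNWs]
      omega
  case sLT =>
    rcases hit : P.it with ⟨_ | it, ht⟩
    · exact ok_wA (hsh _ _ _)
    · have hmul : (it + 1) * RS n = it * RS n + RS n := Nat.succ_mul _ _
      refine ok_w2_n2or ?_ (lb_pos L _)
      simp only [List.mem_cons, List.not_mem_nil, or_false, forall_eq_or_imp, forall_eq]
      refine ⟨n1ok_n1and ?_ (lb_pos L _), n1ok_n1and ?_ (lb_pos L _), n1ok_n1and ?_ (lb_pos L _),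
        n1ok_n1and ?_ (lb_pos L _)⟩ <;>
      simp only [List.mem_cons, List.not_mem_nil, or_false, forall_eq_or_imp, forall_eq, al_aFrz, al_aConn,
        al_aNWs, al_aLT, al_aFLT, Fin.val_last] <;> omega
  case sC =>
    rcases hit : P.it with ⟨_ | it, ht⟩
    · exact ok_wA (al_ffA_lt L _)
    · have hmul : (it + 1) * RS n = it * RS n + RS n := Nat.succ_mul _ _
      refine ok_w2_n2or ?_ (lb_pos L _)
      simp only [List.mem_cons, List.not_mem_nil, or_false, forall_eq_or_imp, forall_eq]
      refine ⟨n1ok_litN1 (by (simp; omega)) (lb_pos L _), n1ok_n1and ?_ (lb_pos L _)⟩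
      simp only [List.mem_cons, List.not_mem_nil, or_false, forall_eq_or_imp, forall_eq, al_aFrz, al_aConn, al_aSel]
      omega
  case sARR =>
    rcases hit : P.it with ⟨_ | it, ht⟩
    · exact ok_wA (al_ffA_lt L _)
    · have hmul : (it + 1) * RS n = it * RS n + RS n := Nat.succ_mul _ _
      refine ok_w1_n1or ?_ (lb_pos L _)
      simp only [List.mem_cons, List.not_mem_nil, or_false, forall_eq_or_imp, forall_eq, al_aARR, al_aNow]; omega
  case sDEAD =>
    rcases hit : P.it with ⟨_ | it, ht⟩
    · exact ok_wA (al_ffA_lt L _)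
    · have hmul : (it + 1) * RS n = it * RS n + RS n := Nat.succ_mul _ _
      refine ok_w2_n2or ?_ (lb_pos L _)
      simp only [List.mem_cons, List.not_mem_nil, or_false, forall_eq_or_imp, forall_eq]
      refine ⟨n1ok_litN1 (by (simp; omega)) (lb_pos L _), n1ok_n1and ?_ (lb_pos L _), n1ok_n1and ?_ (lb_pos L _),
        n1ok_n1and ?_ (lb_pos L _)⟩
      · simp only [List.mem_cons, List.not_mem_nil, or_false, forall_eq_or_imp, forall_eq, al_aFrz, al_aCnt1]; omega
      · simp only [List.mem_cons, List.not_mem_nil, or_false, forall_eq_or_imp, forall_eq, al_aFrz, al_aConn,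
          al_aHasSel]; omega
      · intro l hl
        rw [List.mem_append] at hl
        rcases hl with hl | hl
        · simp only [List.mem_cons, List.not_mem_nil, or_false] at hl
          rcases hl with rfl | rfl <;> (simp; omega)
        · split_ifs at hl with hU
          · simp at hl
          · simp only [List.mem_singleton] at hl; subst hl; (simp; omega)
  case frz => split_ifs <;> exact ok_wA (by simp)
  case now =>
    refine ok_append (fun v => ?_) (fun v => ?_) i <;> split_ifs <;>
      first | exact ok_wA (by simp) | exact ok_wN (by simp)
  case cnt1 => exact ok_cnt (fun v => ok_wN (by simp)) (lb_pos L _) i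
  case sw =>
    refine ok_cnt (ok_append (ok_append (fun j => ?_) (fun j => ?_)) (fun j => ?_)) (lb_pos L _) i
    · refine ok_w1_n1and ?_ (lb_pos L _)
      simp only [List.mem_cons, List.not_mem_nil, or_false, forall_eq_or_imp, forall_eq, al_aW, al_aLT]
      refine ⟨by omega, by omega, by omega, by omega, by omega, by omega, al_adjLit_lt L _ _ _⟩
    · refine ok_w1_n1and ?_ (lb_pos L _)
      simp only [List.mem_cons, List.not_mem_nil, or_false, forall_eq_or_imp, forall_eq, al_aW, al_aLT]
      refine ⟨by omega, by omega, by omega, by omega, by omega, by omega, al_adjLit_lt L _ _ _⟩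
    · refine ok_w1_n1or ?_ (lb_pos L _)
      simp only [List.mem_cons, List.not_mem_nil, or_false, forall_eq_or_imp, forall_eq, al_aW, al_aLT]; omega
  case reach =>
    rcases hrd : P.rd with ⟨_ | s, hs⟩
    · exact ok_reach0W L _ _ _ (by simp)
    · refine ok_w1_n1and ?_ (lb_pos L _)
      simp only [List.mem_cons, List.not_mem_nil, or_false, forall_eq_or_imp, forall_eq, al_aReach]; omega
  case conn =>
    refine ok_w1_n1or ?_ (lb_pos L _)
    simp only [List.mem_cons, List.not_mem_nil, or_false, forall_eq_or_imp, forall_eq, al_aW, al_aReach, Fin.val_last]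
    omega
  case szGE =>
    exact ok_append (fun y => ok_w1 (ok_WEF L _ _ _ (by omega)) (lb_pos L _))
      (fun y => ok_w1 (ok_nWEF L _ _ _ (by omega)) (lb_pos L _)) i
  case big => exact ok_cnt (fun y => ok_w1 (ok_WEF L _ _ _ (by omega)) (lb_pos L _)) (lb_pos L _) i
  case bmc =>
    refine ok_append (fun w => ?_) (fun a => ?_) i
    · refine ok_w2_n2or ?_ (lb_pos L _)
      simp only [List.mem_cons, List.not_mem_nil, or_false, forall_eq_or_imp, forall_eq]
      refine ⟨n1ok_litN1 (by simp) (lb_pos L _), n1ok_litN1 (by simp) (lb_pos L _),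
        n1ok_litN1 (by simp) (lb_pos L _), n1ok_n1and ?_ (lb_pos L _)⟩
      simp only [List.mem_cons, List.not_mem_nil, or_false, forall_eq_or_imp, forall_eq, al_aSzGE, al_aLT]; omega
    · split_ifs <;> exact ok_wA (by simp)
  case sel =>
    refine ok_append (fun w => ?_) (fun a => ?_) i
    · split_ifs
      · refine ok_w1_n1or ?_ (lb_pos L _)
        simp only [List.mem_cons, List.not_mem_nil, or_false, forall_eq_or_imp, forall_eq, al_aBmc, al_aC]; omega
      · exact ok_wA (al_ttA_lt L _)
    · split_ifs
      · exact ok_wA (by simp)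
      · exact ok_wN (by simp)
      · exact ok_wA (al_ffA_lt L _)
  case hasSel => exact ok_wA (by simp)
  case pok => split_ifs <;> exact ok_wA (by (simp <;> omega))
  case nWs => split_ifs <;> exact ok_wA (by (simp <;> omega))
  case fLT =>
    rcases hrd : P.rd with ⟨_ | t, ht⟩
    · exact ok_iLTW L _ _ _ (by simp)
    · refine ok_w2_n2or ?_ (lb_pos L _)
      simp only [List.mem_cons, List.not_mem_nil, or_false, forall_eq_or_imp, forall_eq]
      refine ⟨n1ok_litN1 (by simp) (lb_pos L _), n1ok_n1and ?_ (lb_pos L _)⟩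
      simp only [List.mem_cons, List.not_mem_nil, or_false, forall_eq_or_imp, forall_eq, al_aFLT, al_aFlex]; omega
  case fcge =>
    refine ok_append (fun w' => ok_w1_n1and ?_ (lb_pos L _)) (fun w' => ok_w1_n1or ?_ (lb_pos L _)) i
    · simp only [List.mem_cons, List.not_mem_nil, or_false, forall_eq_or_imp, forall_eq, al_aW, al_aFLT]
      exact ⟨by omega, by omega, al_adjLit_lt L _ _ _, by omega, by omega⟩
    · simp only [List.mem_cons, List.not_mem_nil, or_false, forall_eq_or_imp, forall_eq, al_aW, al_aFLT]
      exact ⟨by omega, by omega, al_nadjLit_lt L _ _ _, by omega, by omega⟩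
  case fallb =>
    refine ok_w2_n2or ?_ (lb_pos L _)
    simp only [List.mem_cons, List.not_mem_nil, or_false, forall_eq_or_imp, forall_eq]
    refine ⟨n1ok_litN1 (by simp) (lb_pos L _), n1ok_n1and ?_ (lb_pos L _)⟩
    simp only [List.mem_cons, List.not_mem_nil, or_false, forall_eq_or_imp, forall_eq, al_aFcge]; omega
  case flex =>
    refine ok_w1_n1and ?_ (lb_pos L _)
    simp only [List.mem_cons, List.not_mem_nil, or_false, forall_eq_or_imp, forall_eq, al_aFcge, al_aFallb]; omega

end Replay

end WCan

end Summit.PneNP.PneNP.Theorems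

end
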